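import Summits.AtomisticToContinuum.HydrodynamicLimit.Theses.InformationPercolationEngine
import Literature.MathematicalPhysics.KineticTheory.TaggedSphereDiffusionCorrector

/-!
# `SpectralContractionR` is false without its mean-zero hypothesis (load-bearing analysis)

Negative knowledge for the crux `InformationPercolationEngine.SpectralContractionR`
(stmt-AtomisticToContinuum-13913), from the standing disprover's `Cruxes/SpectralContractionR/Disproof.lean`:
`SpectralContractionRWithoutMeanZero` is the crux VERBATIM with the hypothesis `∫ f νM = 0` deleted, and it is
FALSE — the constant function `f ≡ 1` is measurable, `f² νM = νM` is integrable
(`integrable_collisionFrequency_mul_maxwellianBeta` at `β = 1`, `maxwellianBeta_one`), `K 1 = 1` pointwise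
(`K` is Markov: `ν > 0` by `exists_collisionFrequency_lowerBound`), so the conclusion reads `Z ≤ c Z` with
`Z = ∫ νM > 0` and `c < 1/2`. Hence ANY proof of the crux must use the mean-zero hypothesis (the top eigenvalue
`1` of `K` sits exactly on the constants). refuter-cdisprove-stmt-AtomisticToContinuum-13913-0.
-/

noncomputable section

open MeasureTheory Metric Real Set Filter Topology
open scoped InnerProductSpace ENNReal

namespace Summit.AtomisticToContinuum.HydrodynamicLimit.Theorems

open Literature.MathematicalPhysics.KineticTheory
open Literature.Analysis.FunctionSpaces (maxwellianBeta maxwellianBeta_one maxwellianBeta_pos)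
open Literature.Analysis.FluidPDE (globalMaxwellian globalMaxwellian_pos)

/-- The crux `SpectralContractionR` with the MEAN-ZERO hypothesis `∫ f νM = 0` dropped (all else verbatim). -/
def SpectralContractionRWithoutMeanZero : Prop :=
  ∃ c : ℝ, c < 1 / 2 ∧ let M : Literature.MathematicalPhysics.KineticTheory.V3 → ℝ := Literature.Analysis.FluidPDE.globalMaxwellian; let S : MeasureTheory.Measure (Metric.sphere (0 : Literature.MathematicalPhysics.KineticTheory.V3) 1) := Literature.MathematicalPhysics.KineticTheory.sphereMeasure; let ν : Literature.MathematicalPhysics.KineticTheory.V3 → ℝ := fun v => ∫ w, ∫ ω, Literature.MathematicalPhysics.KineticTheory.hardSphereKernel (v, w) ω * M w ∂S; let K : (Literature.MathematicalPhysics.KineticTheory.V3 → ℝ) → Literature.MathematicalPhysics.KineticTheory.V3 → ℝ := fun f v => (ν v)⁻¹ * ∫ w, ∫ ω, Literature.MathematicalPhysics.KineticTheory.hardSphereKernel (v, w) ω * M w * f (Literature.MathematicalPhysics.KineticTheory.collide ω (v, w)).1 ∂S; ∀ f : Literature.MathematicalPhysics.KineticTheory.V3 → ℝ, Measurable f → MeasureTheory.Integrable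 (fun v => f v ^ 2 * (ν v * M v)) → ∫ v, K f v ^ 2 * (ν v * M v) ≤ c * ∫ v, f v ^ 2 * (ν v * M v)

namespace SpectralContractionRWithoutMeanZero

/-- `ν = a₁`: the crux's collision frequency is the tree's `collisionFrequency` at `β = 1`. [folklore] -/
theorem nu_eq (v : V3) :
    ∫ w, ∫ ω, hardSphereKernel (v, w) ω * globalMaxwellian w ∂sphereMeasure =
      TaggedSphereDiffusion.collisionFrequency (d := Fin 3) 1 v := by
  simp only [TaggedSphereDiffusion.collisionFrequency, maxwellianBeta_one]

/-- `ν > 0` everywhere. [folklore] -/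
theorem nu_pos (v : V3) :
    0 < ∫ w, ∫ ω, hardSphereKernel (v, w) ω * globalMaxwellian w ∂sphereMeasure := by
  obtain ⟨a₀, ha₀, c, _, hlow⟩ :=
    exists_collisionFrequency_lowerBound (d := Fin 3) (by simp : 2 ≤ Fintype.card (Fin 3)) one_pos
  rw [nu_eq]
  exact ha₀.trans_le (hlow v).1

/-- `ν M` is integrable. [folklore] -/
theorem integrable_nuM :
    Integrable (fun v : V3 =>
      (∫ w, ∫ ω, hardSphereKernel (v, w) ω * globalMaxwellian w ∂sphereMeasure) * globalMaxwellian v) := by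
  have h := integrable_collisionFrequency_mul_maxwellianBeta (d := Fin 3) (β := 1) one_pos
  rw [maxwellianBeta_one] at h
  refine h.congr (Eventually.of_forall fun v => ?_)
  simp only [nu_eq]

/-- `Z = ∫ ν M > 0`. [folklore] -/
theorem integral_nuM_pos :
    0 < ∫ v : V3,
      (∫ w, ∫ ω, hardSphereKernel (v, w) ω * globalMaxwellian w ∂sphereMeasure) * globalMaxwellian v := by
  have hnn : 0 ≤ fun v : V3 =>
      (∫ w, ∫ ω, hardSphereKernel (v, w) ω * globalMaxwellian w ∂sphereMeasure) * globalMaxwellian v :=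
    fun v => mul_nonneg (nu_pos v).le (globalMaxwellian_pos v).le
  rw [integral_pos_iff_support_of_nonneg hnn integrable_nuM]
  have hsupp : Function.support (fun v : V3 =>
      (∫ w, ∫ ω, hardSphereKernel (v, w) ω * globalMaxwellian w ∂sphereMeasure) * globalMaxwellian v) =
      Set.univ := by
    ext v
    simp only [Function.mem_support, Set.mem_univ, iff_true]
    exact (mul_pos (nu_pos v) (globalMaxwellian_pos v)).ne'
  rw [hsupp]
  simp

/-- `K 1 = 1`: the one-collision operator is Markov. [folklore] -/
theorem K_one (v : V3) :
    (∫ w, ∫ ω, hardSphereKernel (v, w) ω * globalMaxwellian w ∂sphereMeasure)⁻¹ *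
        ∫ w, ∫ ω, hardSphereKernel (v, w) ω * globalMaxwellian w *
          (fun _ : V3 => (1 : ℝ)) (collide ω (v, w)).1 ∂sphereMeasure = 1 := by
  simp only [mul_one]
  exact inv_mul_cancel₀ (nu_pos v).ne'

end SpectralContractionRWithoutMeanZero

open SpectralContractionRWithoutMeanZero in
/-- ANY PROOF OF THE CRUX MUST USE MEAN-ZERO: `SpectralContractionR` minus `∫ f νM = 0` is false, witness
`f ≡ 1` (`K 1 = 1`, so the conclusion is `Z ≤ cZ`, `Z = ∫ νM > 0`, `c < 1/2`). [folklore] -/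
theorem spectralContractionR_false_without_meanZero : ¬ SpectralContractionRWithoutMeanZero := by
  rintro ⟨c, hc, h⟩
  have hint : Integrable (fun v : V3 => (fun _ : V3 => (1 : ℝ)) v ^ 2 *
      ((∫ w, ∫ ω, hardSphereKernel (v, w) ω * globalMaxwellian w ∂sphereMeasure) *
        globalMaxwellian v)) := by
    refine integrable_nuM.congr (Eventually.of_forall fun v => ?_)
    simp only [one_pow, one_mul]
  have h1 := h (fun _ => (1 : ℝ)) measurable_const hint
  simp only [K_one, one_pow, one_mul] at h1
  have hZ := integral_nuM_pos
  nlinarith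

end Summit.AtomisticToContinuum.HydrodynamicLimit.Theorems

end
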